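import Literature.AlgebraicGeometry.Modules.TensorSheafHomIso
import Literature.AlgebraicGeometry.Modules.PullbackDual
import Literature.AlgebraicGeometry.Modules.TensorBraiding
import Literature.AlgebraicGeometry.KTheory.PullbackVectorBundle
import HarnessLib

/-!
# Pull-back and tensor product with ONE finite locally free factor: `f^*(L ⊗ M) ≅ f^*L ⊗ f^*M` for `L` a
# vector bundle and `M` ARBITRARY, natural in `M` (Stacks 01CA for one locally free factor; Hartshorne II Ex. 5.1)

Layer `Literature/AlgebraicGeometry/Modules`. The tree has the comparison `f^*(M ⊗ N) ⟶ f^*M ⊗ f^*N` for all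
modules (`Modules/PullbackTensor.pullbackTensorHom`) and its ISOMORPHISM half when BOTH factors are finite locally
free (`pullbackTensorIso`); the statement for arbitrary modules is only DISPLAYED (`Modules/PullbackTensorProduct.PullbackTensorObjIso`,
a named fact). Here the intermediate case that the Fourier–Mukai plumbing needs — ONE factor finite locally free,
the other arbitrary — PROVED (0 named facts) by the tree's `𝓗om(L^∨, –)`-model of `L ⊗ –`:

  `f^*(L ⊗ M) ≅ f^* 𝓗om(L^∨, M)`            (`Modules/TensorSheafHomIso.tensorSheafHomDualIso`, `L` f.l.f., any `M`)
  `          ≅ 𝓗om((f^*L)^∨, f^*M)`          (`Modules/PullbackDual.pullbackTwistIso`: base change of `𝓗om` for a f.l.f.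
                                              first argument, `Modules/SheafHomPullbackIso`, and `f^*(L^∨) ≅ (f^*L)^∨`)
  `          ≅ f^*L ⊗ f^*M`                   (`tensorSheafHomDualIso` again, `f^*L` f.l.f. — `KTheory/PullbackVectorBundle`).

* **`pullbackTensorNatIsoOfLeft f hL : (L ⊗ –) ⋙ f^* ≅ f^* ⋙ (f^*L ⊗ –)`** (natural in the arbitrary factor);
* **`pullbackTensorIsoOfLeft f hL M : f^*(L ⊗ M) ≅ f^*L ⊗ f^*M`** (its component) and `pullbackTensorIsoOfLeft_hom_naturality`;
* **`pullbackTensorIsoOfRight f M hL : f^*(M ⊗ L) ≅ f^*M ⊗ f^*L`** (by the braiding `Modules/TensorBraiding.tensorComm`).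

Not here: the comparison of this isomorphism with `pullbackTensorHom` on sections (both send `η(l ⊗ m)` to `η(l) ⊗ η(m)`;
not needed downstream), and the case of two arbitrary factors (stalks; the displayed `PullbackTensorObjIso`).
Typed for the cell `pub-hodge-ring2` (plate P4 of crux 26512's (M1) library debt: `p_A^*(M ⊗ P_α) ≅ p_A^*M ⊗ p_A^*P_α`
and `(1 × t_α)^*(𝒫 ⊗ N) ≅ (1 × t_α)^*𝒫 ⊗ (1 × t_α)^*N` with `M`, `N` arbitrary); a research route conditional on HC_CM,
not a corollary — nothing in this file refers to it.

## References

* The Stacks Project, Tag 01CA (Modules, Lemma 17.16.4: `f^*(𝓕 ⊗ 𝓖) = f^*𝓕 ⊗ f^*𝓖` functorially). [StacksProject]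
* R. Hartshorne, *Algebraic Geometry* (1977), II Ex. 5.1 (b), (d) (`𝓗om(𝓔, 𝓕) ≅ 𝓔^∨ ⊗ 𝓕`; `f^*` of locally free). [Hartshorne1977]
* U. Görtz, T. Wedhorn, *Algebraic Geometry I* (2020), (7.8.2)–(7.8.3), Exercise 7.20 (a). [GortzWedhorn2020]
-/

noncomputable section

-- `TopCat.Presheaf`/`Scheme.Modules` are not reducible (as in Mathlib's `AlgebraicGeometry/Modules/Sheaf.lean`).
set_option backward.isDefEq.respectTransparency false

open CategoryTheory AlgebraicGeometry

universe u

namespace Literature.AlgebraicGeometry.Modules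

open Literature.AlgebraicGeometry.Motives

variable {X Y : Scheme.{u}} (f : X ⟶ Y) {L : Y.Modules} (hL : IsFiniteLocallyFree L)

/-- **Base change of the twist functor `𝓗om(L^∨, –)`** for `L` finite locally free, as a natural isomorphism
`𝓗om(L^∨, –) ⋙ f^* ≅ f^* ⋙ 𝓗om((f^*L)^∨, –)` (components `Modules/PullbackDual.pullbackTwistIso`, naturality
`pullbackTwistComparison_naturality`). [cite: GortzWedhorn2020, (7.8.3) and Exercise 7.20 (a)] [cite: Hartshorne1977, II Ex. 5.1 (b) and (d)] -/
def pullbackTwistNatIso :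
    sheafHomFunctor (dual L) ⋙ Scheme.Modules.pullback f ≅
      Scheme.Modules.pullback f ⋙ sheafHomFunctor (dual ((Scheme.Modules.pullback f).obj L)) :=
  NatIso.ofComponents (fun M => pullbackTwistIso f hL M) (fun g => pullbackTwistComparison_naturality f hL g)

/-- **`(L ⊗ –) ⋙ f^* ≅ f^* ⋙ (f^*L ⊗ –)` for `L` finite locally free** — pull-back commutes with tensoring by a vector
bundle, NATURALLY IN THE ARBITRARY FACTOR: `L ⊗ – ≅ 𝓗om(L^∨, –)` on `Y`, base change of `𝓗om`, and
`𝓗om((f^*L)^∨, –) ≅ f^*L ⊗ –` on `X`. [cite: StacksProject, Tag 01CA (Lemma 17.16.4)] [cite: Hartshorne1977, II Ex. 5.1 (b)] -/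
def pullbackTensorNatIsoOfLeft :
    (tensorBifunctor Y).obj L ⋙ Scheme.Modules.pullback f ≅
      Scheme.Modules.pullback f ⋙ (tensorBifunctor X).obj ((Scheme.Modules.pullback f).obj L) :=
  Functor.isoWhiskerRight (tensorSheafHomDualNatIso L hL) (Scheme.Modules.pullback f) ≪≫ pullbackTwistNatIso f hL ≪≫
    Functor.isoWhiskerLeft (Scheme.Modules.pullback f)
      (tensorSheafHomDualNatIso ((Scheme.Modules.pullback f).obj L) (hL.pullback f)).symm

/-- **`f^*(L ⊗ M) ≅ f^*L ⊗ f^*M` for `L` finite locally free and `M` an ARBITRARY `𝒪_Y`-module** (component of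
`pullbackTensorNatIsoOfLeft`). [cite: StacksProject, Tag 01CA (Lemma 17.16.4)] [cite: Hartshorne1977, II Ex. 5.1 (b)] -/
def pullbackTensorIsoOfLeft (M : Y.Modules) :
    (Scheme.Modules.pullback f).obj (tensorObj L M) ≅
      tensorObj ((Scheme.Modules.pullback f).obj L) ((Scheme.Modules.pullback f).obj M) :=
  (pullbackTensorNatIsoOfLeft f hL).app M

/-- The component of `pullbackTensorNatIsoOfLeft` at `M` is `pullbackTensorIsoOfLeft f hL M` (unfolding).
[cite: StacksProject, Tag 01CA (Lemma 17.16.4)] -/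
theorem pullbackTensorNatIsoOfLeft_app (M : Y.Modules) :
    (pullbackTensorNatIsoOfLeft f hL).app M = pullbackTensorIsoOfLeft f hL M := rfl

/-- **Naturality in the arbitrary factor**: `f^*(L ⊗ g) ≫ ι_{M'} = ι_M ≫ (f^*L ⊗ f^*g)` for `g : M ⟶ M'`.
[cite: StacksProject, Tag 01CA (Lemma 17.16.4, "functorially")] -/
@[reassoc]
theorem pullbackTensorIsoOfLeft_hom_naturality {M M' : Y.Modules} (g : M ⟶ M') :
    (Scheme.Modules.pullback f).map (tensorMap (𝟙 L) g) ≫ (pullbackTensorIsoOfLeft f hL M').hom =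
      (pullbackTensorIsoOfLeft f hL M).hom ≫
        tensorMap (𝟙 ((Scheme.Modules.pullback f).obj L)) ((Scheme.Modules.pullback f).map g) :=
  (pullbackTensorNatIsoOfLeft f hL).hom.naturality g

/-- **`f^*(M ⊗ L) ≅ f^*M ⊗ f^*L` for `L` finite locally free on the RIGHT and `M` arbitrary** (braidings
`Modules/TensorBraiding.tensorComm` around `pullbackTensorIsoOfLeft`). [cite: StacksProject, Tag 01CA (Lemma 17.16.4)] -/
def pullbackTensorIsoOfRight (M : Y.Modules) :
    (Scheme.Modules.pullback f).obj (tensorObj M L) ≅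
      tensorObj ((Scheme.Modules.pullback f).obj M) ((Scheme.Modules.pullback f).obj L) :=
  (Scheme.Modules.pullback f).mapIso (tensorComm M L) ≪≫ pullbackTensorIsoOfLeft f hL M ≪≫ tensorComm _ _

/-- `(– ⊗ L) ⋙ f^* ≅ f^* ⋙ (– ⊗ f^*L)` for `L` finite locally free, natural in the arbitrary left factor
(`(tensorBifunctor Y).flip.obj L = – ⊗ L`). [cite: StacksProject, Tag 01CA (Lemma 17.16.4, "functorially")] -/
def pullbackTensorNatIsoOfRight :
    (tensorBifunctor Y).flip.obj L ⋙ Scheme.Modules.pullback f ≅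
      Scheme.Modules.pullback f ⋙ (tensorBifunctor X).flip.obj ((Scheme.Modules.pullback f).obj L) :=
  NatIso.ofComponents (fun M => pullbackTensorIsoOfRight f hL M) (fun {M M'} g => by
    change (Scheme.Modules.pullback f).map (tensorMap g (𝟙 L)) ≫
        ((Scheme.Modules.pullback f).map (tensorComm M' L).hom ≫ (pullbackTensorIsoOfLeft f hL M').hom ≫
          (tensorComm _ _).hom) =
      ((Scheme.Modules.pullback f).map (tensorComm M L).hom ≫ (pullbackTensorIsoOfLeft f hL M).hom ≫
          (tensorComm _ _).hom) ≫
        tensorMap ((Scheme.Modules.pullback f).map g) (𝟙 ((Scheme.Modules.pullback f).obj L))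
    rw [← Functor.map_comp_assoc, tensorMap_tensorComm_hom, Functor.map_comp_assoc, Category.assoc, Category.assoc,
      pullbackTensorIsoOfLeft_hom_naturality_assoc, tensorMap_tensorComm_hom])

end Literature.AlgebraicGeometry.Modules

end
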